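import Literature.NumberTheory.EllipticCurves.BhargavaShankarLatticeCount
import Literature.Algebra.EuclideanLattices.ResidueClassLatticePointCountingProofs
import Literature.MeasureTheory.Group.GL2ZFundamentalDomain
import HarnessLib

/-!
# The lattice-point count of `S_g` in residue classes, and a pointwise majorant for the counting
# function of the averaging method with congruence conditions (Bhargava–Shankar §2.3, §2.5)

`Proofs` file (theorems only: no definitions, no named facts). Topic
`Literature/NumberTheory/EllipticCurves`; combines `BhargavaShankarLatticeCount.lean` (the patches
`patch D g X` covering `frontier S_g`, their anisotropic Lipschitz constants `Λ · (y², y, 1, y⁻¹, y⁻²)`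
and the count `abs_latticeCount_sub_le`), the residue-class form of the Lipschitz cube count
(`Literature.Algebra.EuclideanLattices.abs_sum_weight_sub_density_mul_volume_le`,
`…abs_ncard_residue_sub_volume_le_of_forall_patch`), the cusp lemma
`BhargavaShankarCoefficientBoxes.e_eq_zero_of_cusp` and the counting function `countFn` of
`BhargavaShankarUnfolding.lean`.

Bhargava–Shankar prove Thm 2.11 of `arXiv:1006.1002v2` (= Thm 2.12 of the published version: the
count `N(S ∩ V^{(i)}; X)` for a set `S ⊂ V_ℤ` defined by congruence conditions) "in the same way as
Thm 2.1", counting the lattice points of each translate `𝓛_j` of `m · V_ℤ` in the regions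
`B(n,t,λ,X)` by Davenport's lemma (§2.5: "`S` may be viewed as the union of `k` translates
`𝓛₁, …, 𝓛_k` of the lattice `m · V_ℤ`"). This file provides the per-`g` input of that argument
for the UPPER bound:

* `abs_residueLatticeCount_sub_le` — for `X ≥ 1`, `g = ñ(x) a(√y) k(θ)` in the Siegel set
  (`|x| ≤ ½`, `y ≥ √3/2`) and in the main body (`Λ y⁻² ≥ 1`), for every modulus `q ≥ 1` and residue
  `r ∈ (ℤ/qℤ)⁵`: `|#{z ∈ ℤ⁵ ∩ S_g : z ≡ r (q)} − X^{5/6} vol(B₁)/q⁵| ≤ 576000 K Λ⁴ y²`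
  (the same error as for `q = 1`, uniformly in `q` and `r`);
* `residueSetCount_le` — hence for a set `S ⊆ (ℤ/qℤ)⁵` of residues,
  `#{z ∈ ℤ⁵ ∩ S_g : z mod q ∈ S} ≤ #S · (X^{5/6} vol(B₁)/q⁵ + 576000 K Λ⁴ y²)`;
* `e_eq_zero_of_lt_one` — in the cusp `Λ y⁻² < 1` every integral form counted at `g` has `e = 0`
  (so no irreducible form is counted there);
* `countFn_eq_encard` — `N(g) = #{x ∈ 𝒮 : g ∈ E(x)}`, and the **pointwise majorant**
  `countFn_le_majorant`: for a set `𝒮` of irreducible integral forms whose reductions modulo `q`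
  lie in `S`, and every `g` in Gauss's fundamental domain `𝓕`,
  `N(g) ≤ #S·X^{5/6} vol(B₁)/q⁵ + #S·576000 K Λ⁴ · y(g)² · 1_{y(g) ≤ √Λ}`.

Integrating the majorant over `𝓕` (`μ(𝓕) = π²/3`, `∫ y² · y⁻² dx dy ≤ √Λ`) gives the upper
bound of Thm 2.12 with error `O(X^{3/4})`; this is done in the companion assembly file.

## References

* M. Bhargava, A. Shankar, Ann. of Math. (2) 181 (2015) 191–242, §2.3 (Prop. 2.6, (12)–(15)) and
  §2.5 (Thm 2.11 of arXiv:1006.1002v2 = Thm 2.12 published). [cite: BhargavaShankarAnnals2015, §2.5 Thm 2.11 (arXiv:1006.1002v2 numbering; = Thm 2.12 published)]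
-/

noncomputable section

open Real MeasureTheory Matrix Set Filter Topology
open scoped MatrixGroups ENNReal

namespace Literature.NumberTheory.EllipticCurves

namespace BinaryQuartic

open Literature.MeasureTheory.Group Literature.Algebra.EuclideanLattices

variable {K : ℕ} (D : Fin K → Piece)

/-! ## The error term, uniformly in the modulus -/

/-- The arithmetic of the error term: with `n = ⌈Λ y⁻²⌉`, in the main body `Λ y⁻² ≥ 1`,
`10K · n⁴ ∏ᵢ (2Λdᵢ/(q n) + 2) ≤ 576000 K Λ⁴ y²` for every modulus `q ≥ 1` (for `q = 1` this is
the computation inside `abs_latticeCount_sub_le`). [folklore] -/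
theorem errorSum_le {X : ℝ} (hX : 1 ≤ X) {y : ℝ} (hy : Real.sqrt 3 / 2 ≤ y)
    (hbody : 1 ≤ Lam D X * (y⁻¹) ^ 2) {q : ℕ} (hq : 1 ≤ q) :
    ∑ _p : PatchIdx K, ((⌈Lam D X * (y⁻¹) ^ 2⌉₊ : ℕ) : ℝ) ^ 4 *
        ∏ i, (2 * (Lam D X * dWeight y i) / (q * (⌈Lam D X * (y⁻¹) ^ 2⌉₊ : ℕ)) + 2) ≤
      576000 * K * Lam D X ^ 4 * y ^ 2 := by
  have hX0 : 0 < X := by linarith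
  have hy0 : 0 < y := lt_of_lt_of_le (by positivity) hy
  have hΛ := Lam_pos D hX0
  set Λ := Lam D X with hΛdef
  set n : ℕ := ⌈Λ * (y⁻¹) ^ 2⌉₊ with hn
  have hnpos : 0 < n := Nat.ceil_pos.2 (by positivity)
  have hq' : (1 : ℝ) ≤ q := by exact_mod_cast hq
  rw [Finset.sum_const, Finset.card_univ, nsmul_eq_mul]
  have hcard : (Fintype.card (PatchIdx K) : ℝ) = 10 * K := by
    simp [PatchIdx, Fintype.card_prod, Fintype.card_fin, Fintype.card_bool]; ring
  rw [hcard]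
  obtain ⟨p1, p2, p3, p4⟩ := pow_bounds_of_ge hy
  have hnR : Λ * (y⁻¹) ^ 2 ≤ (n : ℝ) := Nat.le_ceil _
  have hnR' : (n : ℝ) ≤ 2 * (Λ * (y⁻¹) ^ 2) := by
    have := Nat.ceil_lt_add_one (by positivity : (0:ℝ) ≤ Λ * (y⁻¹) ^ 2)
    rw [← hn] at this; linarith
  have hnpos' : (0 : ℝ) < n := by exact_mod_cast hnpos
  -- each factor `2 Λ dᵢ / (q n) + 2 ≤ 2 Λ dᵢ / n + 2 ≤ 2 dᵢ y² + 2`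
  have hfac : ∀ i, 2 * (Λ * dWeight y i) / (q * n) + 2 ≤ 2 * (dWeight y i * y ^ 2) + 2 := by
    intro i
    have hd := dWeight_nonneg hy0.le i
    have h0 : 2 * (Λ * dWeight y i) / (q * n) ≤ 2 * (Λ * dWeight y i) / n := by
      refine div_le_div_of_nonneg_left (by positivity) hnpos' ?_
      calc (n : ℝ) = 1 * n := (one_mul _).symm
        _ ≤ q * n := mul_le_mul_of_nonneg_right hq' hnpos'.le
    have h1 : 2 * (Λ * dWeight y i) / n ≤ 2 * (Λ * dWeight y i) / (Λ * (y⁻¹) ^ 2) :=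
      div_le_div_of_nonneg_left (by positivity) (by positivity) hnR
    have h2 : 2 * (Λ * dWeight y i) / (Λ * (y⁻¹) ^ 2) = 2 * (dWeight y i * y ^ 2) := by
      field_simp
    linarith
  rw [Fin.prod_univ_five]
  have d0 : dWeight y 0 * y ^ 2 = y ^ 4 := by simp [dWeight]; ring
  have d1 : dWeight y 1 * y ^ 2 = y ^ 3 := by simp [dWeight]; ring
  have d2 : dWeight y 2 * y ^ 2 = y ^ 2 := by simp [dWeight]
  have d3 : dWeight y 3 * y ^ 2 = y := by simp [dWeight]; field_simp
  have d4 : dWeight y 4 * y ^ 2 = 1 := by simp [dWeight]; field_simp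
  have f0 := hfac 0; have f1 := hfac 1; have f2 := hfac 2; have f3 := hfac 3; have f4 := hfac 4
  rw [d0] at f0; rw [d1] at f1; rw [d2] at f2; rw [d3] at f3; rw [d4] at f4
  have g0 : 2 * (Λ * dWeight y 0) / (q * n) + 2 ≤ 6 * y ^ 4 := by linarith
  have g1 : 2 * (Λ * dWeight y 1) / (q * n) + 2 ≤ 6 * y ^ 3 := by linarith
  have g2 : 2 * (Λ * dWeight y 2) / (q * n) + 2 ≤ 5 * y ^ 2 := by linarith
  have g3 : 2 * (Λ * dWeight y 3) / (q * n) + 2 ≤ 5 * y := by linarith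
  have g4 : 2 * (Λ * dWeight y 4) / (q * n) + 2 ≤ 4 := by linarith
  have pos : ∀ i, 0 ≤ 2 * (Λ * dWeight y i) / (q * n) + 2 := fun i => by
    have := dWeight_nonneg hy0.le i; positivity
  have hprod : (2 * (Λ * dWeight y 0) / (q * n) + 2) * (2 * (Λ * dWeight y 1) / (q * n) + 2) *
      (2 * (Λ * dWeight y 2) / (q * n) + 2) * (2 * (Λ * dWeight y 3) / (q * n) + 2) *
      (2 * (Λ * dWeight y 4) / (q * n) + 2) ≤
      6 * y ^ 4 * (6 * y ^ 3) * (5 * y ^ 2) * (5 * y) * 4 := by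
    have m01 := mul_le_mul g0 g1 (pos 1) (by positivity)
    have m012 := mul_le_mul m01 g2 (pos 2) (by positivity)
    have m0123 := mul_le_mul m012 g3 (pos 3) (by positivity)
    exact mul_le_mul m0123 g4 (pos 4) (by positivity)
  have hn4 : (n : ℝ) ^ 4 ≤ (2 * (Λ * (y⁻¹) ^ 2)) ^ 4 := pow_le_pow_left₀ hnpos'.le hnR' 4
  have hprodnn : 0 ≤ (2 * (Λ * dWeight y 0) / (q * n) + 2) * (2 * (Λ * dWeight y 1) / (q * n) + 2) *
      (2 * (Λ * dWeight y 2) / (q * n) + 2) * (2 * (Λ * dWeight y 3) / (q * n) + 2) *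
      (2 * (Λ * dWeight y 4) / (q * n) + 2) := by
    have := pos 0; have := pos 1; have := pos 2; have := pos 3; have := pos 4; positivity
  have hK : (0 : ℝ) ≤ 10 * K := by positivity
  calc 10 * (K : ℝ) * ((n : ℝ) ^ 4 * ((2 * (Λ * dWeight y 0) / (q * n) + 2) *
        (2 * (Λ * dWeight y 1) / (q * n) + 2) * (2 * (Λ * dWeight y 2) / (q * n) + 2) *
        (2 * (Λ * dWeight y 3) / (q * n) + 2) * (2 * (Λ * dWeight y 4) / (q * n) + 2)))
      ≤ 10 * K * ((2 * (Λ * (y⁻¹) ^ 2)) ^ 4 * (6 * y ^ 4 * (6 * y ^ 3) * (5 * y ^ 2) * (5 * y) * 4)) := by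
        apply mul_le_mul_of_nonneg_left _ hK
        exact mul_le_mul hn4 hprod hprodnn (by positivity)
    _ = 576000 * K * Λ ^ 4 * y ^ 2 := by field_simp; ring

/-! ## The count of `S_g` in one residue class -/

/-- **The lattice-point count of `S_g` in a residue class modulo `q`** (Bhargava–Shankar §2.5:
Davenport's lemma applied to each translate of `m · V_ℤ`; here via the residue-class form of the
Lipschitz cube count): for `X ≥ 1`, `g = ñ(x) a(√y) k(θ)` with `|x| ≤ ½`, `y ≥ √3/2`, in the main
body `Λ y⁻² ≥ 1`, every modulus `q ≥ 1` and residue `r`,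
`|#{z ∈ ℤ⁵ ∩ S_g : z ≡ r (mod q)} − X^{5/6} vol(B₁)/q⁵| ≤ 576000 K Λ⁴ y²`.
[cite: BhargavaShankarAnnals2015, §2.5 (proof of Thm 2.11; arXiv:1006.1002v2 numbering)] -/
theorem abs_residueLatticeCount_sub_le {X : ℝ} (hX : 1 ≤ X) {x y θ : ℝ} (hx : |x| ≤ 1 / 2)
    (hy : Real.sqrt 3 / 2 ≤ y) (hbody : 1 ≤ Lam D X * (y⁻¹) ^ 2) {q : ℕ} [NeZero q]
    (r : Fin 5 → ZMod q) :
    |(({z : Fin 5 → ℤ | (fun i => (z i : ZMod q)) = r ∧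
          intPt z ∈ regionS (sections D X) (iwasawaGinv x y θ)}).ncard : ℝ) -
        X ^ (5 / 6 : ℝ) * volume.real (B1set D) / (q : ℝ) ^ 5| ≤
      576000 * K * Lam D X ^ 4 * y ^ 2 := by
  have hX0 : 0 < X := by linarith
  have hy0 : 0 < y := lt_of_lt_of_le (by positivity) hy
  have hΛ := Lam_pos D hX0
  have hdet : (iwasawaGinv x y θ).det = 1 := det_iwasawaGinv x hy0 θ
  have hq : 1 ≤ q := Nat.one_le_iff_ne_zero.2 (NeZero.ne q)
  set n : ℕ := ⌈Lam D X * (y⁻¹) ^ 2⌉₊ with hn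
  have hnpos : 0 < n := Nat.ceil_pos.2 (by positivity)
  have hmain := abs_ncard_residue_sub_volume_le_of_forall_patch
    (isBounded_regionS_sections D hX0 hx hy)
    (P := PatchIdx K) (m := 4) (patch D (iwasawaGinv x y θ) X) (fun _ i => Lam D X * dWeight y i)
    (fun _ i => mul_nonneg hΛ.le (dWeight_nonneg hy0.le i))
    (fun idx s hs s' hs' i => patch_lipschitz D hX0 hx hy idx hs hs' i)
    (fun _ => n) (fun _ => hnpos)
    (frontier_regionS_subset D hX0 (by rw [hdet]; exact one_ne_zero)) r
  have hvol : volume.real (regionS (sections D X) (iwasawaGinv x y θ)) =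
      X ^ (5 / 6 : ℝ) * volume.real (B1set D) := by
    rw [Measure.real, regionS_sections_eq D hX0, volume_linT_image hdet hX0.le, ENNReal.toReal_mul,
      ENNReal.toReal_ofReal (Real.rpow_nonneg hX0.le _), Measure.real]
  rw [hvol] at hmain
  exact hmain.trans (errorSum_le D hX hy hbody hq)

/-! ## The count of `S_g` in a set of residue classes -/

/-- **The count of `S_g` over a set of residues**: for `S ⊆ (ℤ/qℤ)⁵`, in the main body,
`#{z ∈ ℤ⁵ ∩ S_g : z mod q ∈ S} ≤ #S · (X^{5/6} vol(B₁)/q⁵ + 576000 K Λ⁴ y²)`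
(Bhargava–Shankar §2.5: summing the counts of the `k = #S` translates of `q · V_ℤ`).
[cite: BhargavaShankarAnnals2015, §2.5 (proof of Thm 2.11; arXiv:1006.1002v2 numbering)] -/
theorem residueSetCount_le {X : ℝ} (hX : 1 ≤ X) {x y θ : ℝ} (hx : |x| ≤ 1 / 2)
    (hy : Real.sqrt 3 / 2 ≤ y) (hbody : 1 ≤ Lam D X * (y⁻¹) ^ 2) {q : ℕ} [NeZero q]
    (S : Finset (Fin 5 → ZMod q)) :
    ({z : Fin 5 → ℤ | (fun i => (z i : ZMod q)) ∈ S ∧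
          intPt z ∈ regionS (sections D X) (iwasawaGinv x y θ)}).Finite ∧
    (({z : Fin 5 → ℤ | (fun i => (z i : ZMod q)) ∈ S ∧
          intPt z ∈ regionS (sections D X) (iwasawaGinv x y θ)}).ncard : ℝ) ≤
      S.card * (X ^ (5 / 6 : ℝ) * volume.real (B1set D) / (q : ℝ) ^ 5 + 576000 * K * Lam D X ^ 4 * y ^ 2) := by
  classical
  have hX0 : 0 < X := by linarith
  have hy0 : 0 < y := lt_of_lt_of_le (by positivity) hy
  have hΛ := Lam_pos D hX0
  have hdet : (iwasawaGinv x y θ).det = 1 := det_iwasawaGinv x hy0 θ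
  have hq : 1 ≤ q := Nat.one_le_iff_ne_zero.2 (NeZero.ne q)
  set Sg := regionS (sections D X) (iwasawaGinv x y θ) with hSg
  have hfin : {z : Fin 5 → ℤ | intPt z ∈ Sg}.Finite := finite_setOf_intPt_mem (isBounded_regionS_sections D hX0 hx hy)
  set Z : Finset (Fin 5 → ℤ) := hfin.toFinset with hZ
  have hZmem : ∀ z, z ∈ Z ↔ intPt z ∈ Sg := fun z => by rw [hZ, Set.Finite.mem_toFinset]; rfl
  have hsub : {z : Fin 5 → ℤ | (fun i => (z i : ZMod q)) ∈ S ∧ intPt z ∈ Sg} ⊆ {z | intPt z ∈ Sg} :=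
    fun z hz => hz.2
  refine ⟨hfin.subset hsub, ?_⟩
  -- the count as a weighted count with the indicator weight of `S`
  set Ψ : (Fin 5 → ZMod q) → ℝ := fun r => if r ∈ S then 1 else 0 with hΨ
  have hcount : (({z : Fin 5 → ℤ | (fun i => (z i : ZMod q)) ∈ S ∧ intPt z ∈ Sg}).ncard : ℝ) =
      ∑ z ∈ Z, Ψ (fun i => (z i : ZMod q)) := by
    rw [Finset.sum_ite, Finset.sum_const_zero, add_zero, Finset.sum_const, nsmul_eq_mul, mul_one]
    congr 1
    rw [← Set.ncard_coe_finset]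
    congr 1
    ext z
    simp only [Finset.coe_filter, Set.mem_setOf_eq, hZmem]
    tauto
  set n : ℕ := ⌈Lam D X * (y⁻¹) ^ 2⌉₊ with hn
  have hnpos : 0 < n := Nat.ceil_pos.2 (by positivity)
  have hmain := abs_sum_weight_sub_density_mul_volume_le
    (isBounded_regionS_sections D hX0 hx hy)
    (P := PatchIdx K) (m := 4) (patch D (iwasawaGinv x y θ) X) (fun _ i => Lam D X * dWeight y i)
    (fun _ i => mul_nonneg hΛ.le (dWeight_nonneg hy0.le i))
    (fun idx s hs s' hs' i => patch_lipschitz D hX0 hx hy idx hs hs' i)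
    (fun _ => n) (fun _ => hnpos)
    (frontier_regionS_subset D hX0 (by rw [hdet]; exact one_ne_zero)) Ψ Z hZmem
  have hvol : volume.real Sg = X ^ (5 / 6 : ℝ) * volume.real (B1set D) := by
    rw [Measure.real, hSg, regionS_sections_eq D hX0, volume_linT_image hdet hX0.le, ENNReal.toReal_mul,
      ENNReal.toReal_ofReal (Real.rpow_nonneg hX0.le _), Measure.real]
  have hsumΨ : ∑ r : Fin 5 → ZMod q, Ψ r = S.card := by
    rw [hΨ]; simp [Finset.sum_ite_mem, Finset.univ_inter]
  have hsumabs : ∑ r : Fin 5 → ZMod q, |Ψ r| = S.card := by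
    have : ∀ r, |Ψ r| = Ψ r := fun r => by simp only [hΨ]; split_ifs <;> simp
    simp_rw [this]; exact hsumΨ
  rw [hsumΨ, hsumabs, hvol] at hmain
  have herr := errorSum_le D hX hy hbody hq
  rw [hcount]
  have h1 := (abs_sub_le_iff.1 hmain).1
  have hS0 : (0 : ℝ) ≤ S.card := by positivity
  calc ∑ z ∈ Z, Ψ (fun i => (z i : ZMod q))
      ≤ (S.card : ℝ) / (q : ℝ) ^ 5 * (X ^ (5 / 6 : ℝ) * volume.real (B1set D)) +
          S.card * ∑ _p : PatchIdx K, (n : ℝ) ^ 4 * ∏ i, (2 * (Lam D X * dWeight y i) / (q * n) + 2) := by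
        linarith
    _ ≤ (S.card : ℝ) / (q : ℝ) ^ 5 * (X ^ (5 / 6 : ℝ) * volume.real (B1set D)) +
          S.card * (576000 * K * Lam D X ^ 4 * y ^ 2) := by
        gcongr
    _ = S.card * (X ^ (5 / 6 : ℝ) * volume.real (B1set D) / (q : ℝ) ^ 5 + 576000 * K * Lam D X ^ 4 * y ^ 2) := by
        ring

/-! ## The cusp -/

/-- `C₁ X^{1/6} ≤ Λ = 20 C₁ L X^{1/6}` (`L ≥ 1`). [folklore] -/
theorem C₁_mul_rpow_le_Lam {X : ℝ} (hX : 0 ≤ X) : C₁ * X ^ (1 / 6 : ℝ) ≤ Lam D X := by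
  unfold Lam
  have hL := one_le_Lmax D
  have hC := C₁_pos
  have hX6 := Real.rpow_nonneg hX (1 / 6 : ℝ)
  nlinarith [mul_nonneg hC.le hX6]

/-- **In the cusp `Λ y⁻² < 1` every integral form counted at `g` has `e = 0`** (and is therefore
not irreducible, `not_isIrreducible_of_e_eq_zero`): Bhargava–Shankar's "cutting off the cusp".
[cite: BhargavaShankarAnnals2015, §2.3 (the lattice points with a = 0 in the cusp; arXiv:1006.1002v2 numbering)] -/
theorem e_eq_zero_of_lt_one {X : ℝ} (hX : 1 ≤ X) {x y θ : ℝ} (hx : |x| ≤ 1 / 2)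
    (hy : Real.sqrt 3 / 2 ≤ y) (hcusp : Lam D X * (y⁻¹) ^ 2 < 1) {f : BinaryQuartic ℤ}
    (hf : (f.map (Int.castRingHom ℝ)).coeffs ∈ regionS (sections D X) (iwasawaGinv x y θ)) :
    f.e = 0 := by
  have hX0 : 0 ≤ X := by linarith
  refine e_eq_zero_of_cusp (Real.rpow_nonneg hX0 _) (fun ℓ hℓ l => sections_coeff_le D hX0 hℓ l) hx hy ?_ hf
  calc C₁ * X ^ (1 / 6 : ℝ) * (y⁻¹) ^ 2 ≤ Lam D X * (y⁻¹) ^ 2 :=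
        mul_le_mul_of_nonneg_right (C₁_mul_rpow_le_Lam D hX0) (by positivity)
    _ < 1 := hcusp

/-! ## The counting function as a cardinality -/

/-- For `det g = 1` the set counted at `g` is `{x ∈ 𝒮 : coeffs(x_ℝ) ∈ S_g}`. [folklore] -/
theorem setOf_mem_Eset_eq {𝓛 : Set (BinaryQuartic ℝ)} (𝒮 : Set (BinaryQuartic ℤ)) {g : Matrix (Fin 2) (Fin 2) ℝ}
    (hg : g.det = 1) :
    {x : BinaryQuartic ℤ | x ∈ 𝒮 ∧ g ∈ Eset 𝓛 x} = {x | x ∈ 𝒮 ∧ (x.map (Int.castRingHom ℝ)).coeffs ∈ regionS 𝓛 g} := by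
  ext x; simp only [Set.mem_setOf_eq, mem_Eset_iff_coeffs_mem hg]

/-- `intPt (coeffs x) = coeffs (x_ℝ)`. [folklore] -/
theorem intPt_coeffs (x : BinaryQuartic ℤ) : intPt x.coeffs = (x.map (Int.castRingHom ℝ)).coeffs := by
  rw [coeffs_map_intCast]; rfl

section CountFn

/-- **`N(g) = #{x ∈ 𝒮 : g ∈ E(x)}`** (as an extended natural number, cast to `ℝ≥0∞`). [folklore] -/
theorem countFn_eq_encard (𝓛 : Set (BinaryQuartic ℝ)) (𝒮 : Set (BinaryQuartic ℤ)) (g : Matrix (Fin 2) (Fin 2) ℝ) :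
    countFn 𝓛 𝒮 g = (({x : BinaryQuartic ℤ | x ∈ 𝒮 ∧ g ∈ Eset 𝓛 x}).encard : ℝ≥0∞) := by
  unfold countFn
  rw [tsum_subtype 𝒮 (fun x => (Eset 𝓛 x).indicator 1 g)]
  have e : ∀ x, 𝒮.indicator (fun x => (Eset 𝓛 x).indicator (1 : Matrix (Fin 2) (Fin 2) ℝ → ℝ≥0∞) g) x =
      ({x : BinaryQuartic ℤ | x ∈ 𝒮 ∧ g ∈ Eset 𝓛 x}).indicator 1 x := by
    intro x
    by_cases hx : x ∈ 𝒮 <;> by_cases hg : g ∈ Eset 𝓛 x <;> simp [Set.indicator, hx, hg]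
  rw [tsum_congr e, ← tsum_subtype]
  simp only [Pi.one_apply]
  exact ENNReal.tsum_set_one _

/-- **In the cusp the counting function of a set of irreducible forms vanishes.** [cite: BhargavaShankarAnnals2015, §2.3 (cutting off the cusp; arXiv:1006.1002v2 numbering)] -/
theorem countFn_eq_zero_of_lt_one {X : ℝ} (hX : 1 ≤ X) {x y θ : ℝ} (hx : |x| ≤ 1 / 2)
    (hy : Real.sqrt 3 / 2 ≤ y) (hcusp : Lam D X * (y⁻¹) ^ 2 < 1) {𝒮 : Set (BinaryQuartic ℤ)}
    (hirr : ∀ f ∈ 𝒮, f.IsIrreducible) :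
    countFn (sections D X) 𝒮 (iwasawaGinv x y θ) = 0 := by
  have hy0 : 0 < y := lt_of_lt_of_le (by positivity) hy
  rw [countFn_eq_encard, setOf_mem_Eset_eq 𝒮 (det_iwasawaGinv x hy0 θ)]
  have hempty : {f : BinaryQuartic ℤ | f ∈ 𝒮 ∧ (f.map (Int.castRingHom ℝ)).coeffs ∈ regionS (sections D X) (iwasawaGinv x y θ)} = ∅ := by
    ext f
    simp only [Set.mem_setOf_eq, Set.mem_empty_iff_false, iff_false, not_and]
    intro hf hmem
    exact not_isIrreducible_of_e_eq_zero (e_eq_zero_of_lt_one D hX hx hy hcusp hmem) (hirr f hf)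
  rw [hempty, Set.encard_empty]; simp

/-- **In the main body the counting function is bounded by the residue-set count**: for a set `𝒮`
of integral forms whose reductions modulo `q` lie in `S`,
`N(g) ≤ #S · (X^{5/6} vol(B₁)/q⁵ + 576000 K Λ⁴ y²)`. [cite: BhargavaShankarAnnals2015, §2.5 (proof of Thm 2.11; arXiv:1006.1002v2 numbering)] -/
theorem countFn_le_of_one_le {X : ℝ} (hX : 1 ≤ X) {x y θ : ℝ} (hx : |x| ≤ 1 / 2)
    (hy : Real.sqrt 3 / 2 ≤ y) (hbody : 1 ≤ Lam D X * (y⁻¹) ^ 2) {q : ℕ} [NeZero q]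
    (S : Finset (Fin 5 → ZMod q)) {𝒮 : Set (BinaryQuartic ℤ)}
    (hred : ∀ f ∈ 𝒮, (fun i => ((f.coeffs i : ℤ) : ZMod q)) ∈ S) :
    countFn (sections D X) 𝒮 (iwasawaGinv x y θ) ≤
      ENNReal.ofReal (S.card * (X ^ (5 / 6 : ℝ) * volume.real (B1set D) / (q : ℝ) ^ 5 +
        576000 * K * Lam D X ^ 4 * y ^ 2)) := by
  have hy0 : 0 < y := lt_of_lt_of_le (by positivity) hy
  obtain ⟨hfin, hle⟩ := residueSetCount_le D hX hx hy hbody S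
  set Zset := {z : Fin 5 → ℤ | (fun i => (z i : ZMod q)) ∈ S ∧
    intPt z ∈ regionS (sections D X) (iwasawaGinv x y θ)} with hZset
  rw [countFn_eq_encard, setOf_mem_Eset_eq 𝒮 (det_iwasawaGinv x hy0 θ)]
  set A := {f : BinaryQuartic ℤ | f ∈ 𝒮 ∧ (f.map (Int.castRingHom ℝ)).coeffs ∈ regionS (sections D X) (iwasawaGinv x y θ)}
  have hmaps : Set.MapsTo (fun f : BinaryQuartic ℤ => f.coeffs) A Zset := by
    rintro f ⟨hf, hmem⟩
    exact ⟨hred f hf, by rw [intPt_coeffs]; exact hmem⟩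
  have hinj : Set.InjOn (fun f : BinaryQuartic ℤ => f.coeffs) A := coeffs_injective.injOn
  have h1 : A.encard ≤ Zset.encard := Set.encard_le_encard_of_injOn hmaps hinj
  have h2 : Zset.encard = (Zset.ncard : ℕ∞) := (hfin.cast_ncard_eq).symm
  calc ((A.encard : ℕ∞) : ℝ≥0∞) ≤ ((Zset.encard : ℕ∞) : ℝ≥0∞) := ENat.toENNReal_le.2 h1
    _ = (Zset.ncard : ℝ≥0∞) := by rw [h2, ENat.toENNReal_coe]
    _ = ENNReal.ofReal (Zset.ncard : ℝ) := by rw [ENNReal.ofReal_natCast]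
    _ ≤ _ := ENNReal.ofReal_le_ofReal hle

/-! ## Gauss's fundamental domain in coordinates, and the majorant -/

/-- **Coordinates on Gauss's fundamental domain**: every `g ∈ 𝓕` is `ñ(x) a(√y) k(θ)` with
`x = x(g)`, `y = y(g)`, `|x| ≤ ½` and `y ≥ √3/2`. [folklore] -/
theorem exists_eq_iwasawaGinv_of_mem_gaussFD {g : Matrix (Fin 2) (Fin 2) ℝ} (hg : g ∈ gaussFD) :
    ∃ x y θ : ℝ, |x| ≤ 1 / 2 ∧ Real.sqrt 3 / 2 ≤ y ∧ 0 < y ∧ xOf g = x ∧ yOf g = y ∧ g = iwasawaGinv x y θ := by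
  obtain ⟨hdet, hfd, θ', hθ', hθ⟩ := hg
  obtain ⟨hnorm, hre⟩ := hfd
  have hy : 0 < yOf g := by
    rw [yOf, hdet]
    apply div_pos one_pos
    by_contra hle
    push Not at hle
    have h10 : g 1 0 = 0 := by nlinarith [sq_nonneg (g 1 0), sq_nonneg (g 1 1)]
    have h11 : g 1 1 = 0 := by nlinarith [sq_nonneg (g 1 0), sq_nonneg (g 1 1)]
    have : g.det = 0 := by rw [Matrix.det_fin_two, h10, h11]; ring
    rw [hdet] at this; exact one_ne_zero this
  refine ⟨xOf g, yOf g, θ', by simpa using hre, ?_, hy, rfl, rfl, ?_⟩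
  · -- `x² + y² ≥ 1`, `|x| ≤ 1/2` ⇒ `y ≥ √3/2`
    have hns : 1 ≤ (xOf g) ^ 2 + (yOf g) ^ 2 := by
      rw [Complex.normSq_apply] at hnorm; simpa [sq] using hnorm
    have hx2 : (xOf g) ^ 2 ≤ 1 / 4 := by
      have := abs_le.1 (by simpa using hre : |xOf g| ≤ 1 / 2); nlinarith
    have hy2 : 3 / 4 ≤ (yOf g) ^ 2 := by linarith
    have hs : Real.sqrt 3 / 2 = Real.sqrt (3 / 4) := by
      rw [Real.sqrt_div (by norm_num : (0:ℝ) ≤ 3), show (4:ℝ) = 2 ^ 2 by norm_num, Real.sqrt_sq (by norm_num)]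
    rw [hs, ← Real.sqrt_sq hy.le]
    exact Real.sqrt_le_sqrt hy2
  · set G : SL(2, ℝ) := ⟨g, hdet⟩ with hG
    have hdec := eq_iwasawa G
    have hz : (G • UpperHalfPlane.I : UpperHalfPlane) = ⟨⟨xOf g, yOf g⟩, hy⟩ := by
      apply UpperHalfPlane.ext
      rw [coe_smul_I_eq]
    change g = iwasawa _ at hdec
    rw [hz, show angleOf (G : Matrix (Fin 2) (Fin 2) ℝ) = angleOf g from rfl, ← hθ,
      iwasawa_eq_iwasawaGinv] at hdec
    exact hdec

/-- **The pointwise majorant of the counting function on Gauss's fundamental domain.** Let `𝒮` be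
a set of irreducible integral forms whose reductions modulo `q` lie in `S ⊆ (ℤ/qℤ)⁵`, and
`X ≥ 1`. Then for every `g ∈ 𝓕`,
`N(g) ≤ #S · X^{5/6} vol(B₁)/q⁵ + #S · 576000 K Λ⁴ · y(g)² · 1_{y(g) ≤ √Λ}`
(main body: the residue-set count; cusp `y(g)² > Λ`: no irreducible points).
[cite: BhargavaShankarAnnals2015, §2.3 (14)–(15) and §2.5 Thm 2.11 (arXiv:1006.1002v2 numbering)] -/
theorem countFn_le_majorant {X : ℝ} (hX : 1 ≤ X) {q : ℕ} [NeZero q] (S : Finset (Fin 5 → ZMod q))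
    {𝒮 : Set (BinaryQuartic ℤ)} (hirr : ∀ f ∈ 𝒮, f.IsIrreducible)
    (hred : ∀ f ∈ 𝒮, (fun i => ((f.coeffs i : ℤ) : ZMod q)) ∈ S)
    {g : Matrix (Fin 2) (Fin 2) ℝ} (hg : g ∈ gaussFD) :
    countFn (sections D X) 𝒮 g ≤
      ENNReal.ofReal (S.card * (X ^ (5 / 6 : ℝ) * volume.real (B1set D) / (q : ℝ) ^ 5)) +
        ENNReal.ofReal (S.card * (576000 * K * Lam D X ^ 4)) *
          {g : Matrix (Fin 2) (Fin 2) ℝ | yOf g ≤ Real.sqrt (Lam D X)}.indicator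
            (fun g => ENNReal.ofReal (yOf g ^ 2)) g := by
  have hX0 : 0 < X := by linarith
  obtain ⟨x, y, θ, hx, hy, hy0, -, hyg, rfl⟩ := exists_eq_iwasawaGinv_of_mem_gaussFD hg
  have hΛ := Lam_pos D hX0
  have hS0 : (0 : ℝ) ≤ S.card := Nat.cast_nonneg _
  have hvol0 : 0 ≤ volume.real (B1set D) := measureReal_nonneg
  have hX56 : 0 ≤ X ^ (5 / 6 : ℝ) := Real.rpow_nonneg hX0.le _
  have hq0 : 0 ≤ (q : ℝ) ^ 5 := pow_nonneg (Nat.cast_nonneg _) _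
  have hK0 : (0 : ℝ) ≤ K := Nat.cast_nonneg _
  have hA : 0 ≤ (S.card : ℝ) * (X ^ (5 / 6 : ℝ) * volume.real (B1set D) / (q : ℝ) ^ 5) :=
    mul_nonneg hS0 (div_nonneg (mul_nonneg hX56 hvol0) hq0)
  have hB : 0 ≤ (S.card : ℝ) * (576000 * K * Lam D X ^ 4) :=
    mul_nonneg hS0 (mul_nonneg (mul_nonneg (by norm_num) hK0) (pow_nonneg hΛ.le 4))
  by_cases hbody : 1 ≤ Lam D X * (y⁻¹) ^ 2
  · -- main body: `y² ≤ Λ`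
    have hyΛ : y ≤ Real.sqrt (Lam D X) := by
      rw [← Real.sqrt_sq hy0.le]
      apply Real.sqrt_le_sqrt
      have e : Lam D X * (y⁻¹) ^ 2 = Lam D X / y ^ 2 := by rw [inv_pow]; ring
      rw [e, le_div_iff₀ (pow_pos hy0 2)] at hbody; linarith
    have hmem : iwasawaGinv x y θ ∈ {g : Matrix (Fin 2) (Fin 2) ℝ | yOf g ≤ Real.sqrt (Lam D X)} := by
      show yOf (iwasawaGinv x y θ) ≤ Real.sqrt (Lam D X); rw [hyg]; exact hyΛ
    rw [Set.indicator_of_mem hmem, hyg]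
    refine (countFn_le_of_one_le D hX hx hy hbody S hred).trans (le_of_eq ?_)
    rw [← ENNReal.ofReal_mul hB, ← ENNReal.ofReal_add hA (mul_nonneg hB (sq_nonneg y))]
    congr 1; ring
  · -- cusp
    push Not at hbody
    rw [countFn_eq_zero_of_lt_one D hX hx hy hbody hirr]
    exact zero_le

end CountFn

end BinaryQuartic

end Literature.NumberTheory.EllipticCurves

end
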